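import Literature.Computability.Complexity.AdderBlocks
import Mathlib.Algebra.BigOperators.Fin
import Mathlib.Data.Fintype.BigOperators
import HarnessLib

/-!
# Carry-save counting with MDFA chains (one level of the Demenkov–Kojevnikov–Kulikov–Yaroslavtsev counter)

The `4.5n + o(n)` circuits of Demenkov et al. for symmetric functions compute the binary
representation of `x₁ + ⋯ + xₙ` level by level: the bits of a given weight `2ʲ` ("tokens") are
kept as ONE running bit plus ENCODED PAIRS `(u ⊕ v, v)`, and a chain of MDFA blocks
(`Literature.Computability.Complexity.cktSize_mdfa`, 8 gates each) absorbs the pairs two at a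
time into the running bit, emitting one encoded pair of weight `2ʲ⁺¹` per block; the final
running bit is bit `j` of the sum (Kulikov–Pechenev–Slezkin 2022, §3.1.1: "Apply at most `n/2`
MDFA blocks (no more than `4n` gates)").

This file formalizes ONE LEVEL of that process, for a token configuration
`LIn b c a` = `b ≤ 1` lone bits, `c ≤ 1` extra encoded pair, and `a` pairs of encoded pairs:

* `chainFn a` / `chainFn_spec` / `cktSize_chain`: the chain of `a` MDFAs on a running bit and
  `2a` encoded pairs: `r + Σ pairs = s + 2 · Σ (a encoded carry pairs)`, `8a` gates;
* the four level shapes `levelFn₁₀, levelFn₁₁, levelFn₀₁, levelFn₀₀` (running bit present or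
  not, odd pair present or not), each with its conservation law
  `lval y = s + 2 · upVal (carries)` and its gate count (`8a`, `8a + 4`, `8a + 1`, `8a' + 6`):
  a present lone bit is the running bit; a present odd pair is absorbed by a full adder
  (`cktSize_fa`, 4 gates) or, if no lone bit is present, split (`spC`, 1 gate) to CREATE the
  running bit; with neither, the first pair of pairs is split and full-added and its two
  carries re-encoded by one XOR gate (6 gates).

The carries of a level are again `≤ 1` lone bit and some encoded pairs, so levels compose
(`Literature/Computability/Complexity/MajorityCircuit.lean`).

Sources: E. Demenkov, A. Kojevnikov, A. S. Kulikov, G. Yaroslavtsev, IPL 110 (2010) 264–267;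
A. S. Kulikov, D. Pechenev, N. Slezkin, *SAT-based circuit local improvement*, MFCS 2022, §3.1.1.
The bookkeeping of odd tokens (split / full adder / re-encoding) is ours [folklore-level
engineering]; only gate counts and conservation laws are claimed.
-/

namespace Literature.Computability.Complexity

open Finset GateList

/-! ### Token configurations and their values -/

/-- Index of the bits of `a` pairs of encoded pairs: (pair-of-pairs `j`, which pair `w`,
component: `false ↦ P = u ⊕ v`, `true ↦ v`). [folklore] -/
abbrev PPIdx (a : ℕ) : Type := Fin a × Bool × Bool

/-- Input of an MDFA chain: a running bit and `a` pairs of encoded pairs. [folklore] -/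
abbrev ChIn (a : ℕ) : Type := Unit ⊕ PPIdx a

/-- Output of an MDFA chain: the final running bit and `a` encoded carry pairs. [folklore] -/
abbrev ChOut (a : ℕ) : Type := Unit ⊕ (Fin a × Bool)

/-- Tokens of one level: `b` lone bits, `c` extra encoded pairs, `a` pairs of encoded pairs
(used with `b, c ≤ 1`). [folklore] -/
abbrev LIn (b c a : ℕ) : Type := Fin b ⊕ (Fin c × Bool) ⊕ PPIdx a

/-- Carries of one level: `c` lone bits and `a` encoded pairs (all of the next weight). [folklore] -/
abbrev LUp (c a : ℕ) : Type := Fin c ⊕ (Fin a × Bool)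

/-- Total value of `a` pairs of encoded pairs. [folklore] -/
def ppVal {a : ℕ} (y : PPIdx a → Bool) : ℕ :=
  ∑ jw : Fin a × Bool, pairVal (y (jw.1, jw.2, false)) (y (jw.1, jw.2, true))

/-- Total value of `a` encoded pairs. [folklore] -/
def upPairsVal {a : ℕ} (u : Fin a × Bool → Bool) : ℕ :=
  ∑ j : Fin a, pairVal (u (j, false)) (u (j, true))

/-- Total value of a level's tokens (all of the same weight). [folklore] -/
def lval {b c a : ℕ} (y : LIn b c a → Bool) : ℕ :=
  (∑ i : Fin b, (y (.inl i)).toNat) +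
    (∑ i : Fin c, pairVal (y (.inr (.inl (i, false)))) (y (.inr (.inl (i, true))))) +
    ppVal fun p => y (.inr (.inr p))

/-- Total value of a level's carries. [folklore] -/
def upVal {c a : ℕ} (u : LUp c a → Bool) : ℕ :=
  (∑ i : Fin c, (u (.inl i)).toNat) + upPairsVal fun p => u (.inr p)

/-- Peeling the first pair of pairs off `ppVal`. [folklore] -/
theorem ppVal_succ {a : ℕ} (y : PPIdx (a + 1) → Bool) :
    ppVal y = pairVal (y (0, false, false)) (y (0, false, true)) +
      pairVal (y (0, true, false)) (y (0, true, true)) + ppVal fun p : PPIdx a => y (p.1.succ, p.2) := by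
  simp only [ppVal, Fintype.sum_prod_type, Fin.sum_univ_succ, Fintype.sum_bool]
  rw [Finset.sum_add_distrib]
  omega

/-- No pairs are worth nothing. [folklore] -/
@[simp] theorem ppVal_zero (y : PPIdx 0 → Bool) : ppVal y = 0 := by simp [ppVal]

/-- Peeling the first encoded pair off `upPairsVal`. [folklore] -/
theorem upPairsVal_succ {a : ℕ} (u : Fin (a + 1) × Bool → Bool) :
    upPairsVal u = pairVal (u (0, false)) (u (0, true)) + upPairsVal fun p : Fin a × Bool =>
      u (p.1.succ, p.2) := by
  simp only [upPairsVal, Fin.sum_univ_succ]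

/-- No carry pairs are worth nothing. [folklore] -/
@[simp] theorem upPairsVal_zero (u : Fin 0 × Bool → Bool) : upPairsVal u = 0 := by
  simp [upPairsVal]

/-! ### The MDFA chain -/

/-- The first MDFA of a chain reads the running bit and the first pair of pairs. [folklore] -/
def mdIn {a : ℕ} (y : ChIn (a + 1) → Bool) : Option Bool → Bool :=
  mdOut (y (.inl ())) (y (.inr (0, false, false))) (y (.inr (0, false, true)))
    (y (.inr (0, true, false))) (y (.inr (0, true, true)))

/-- After the first MDFA: its sum bit is the new running bit, the other pairs remain. [folklore] -/
def chainRest {a : ℕ} (y : ChIn (a + 1) → Bool) : ChIn a → Bool :=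
  Sum.elim (fun _ => mdIn y none) fun p => y (.inr (p.1.succ, p.2))

/-- **The MDFA chain** on a running bit and `a` pairs of encoded pairs: block `j` absorbs pair of
pairs `j` into the running bit and emits the encoded carry pair `j`. [cite: KulikovPechenevSlezkin2022, §3.1.1] -/
def chainFn : (a : ℕ) → (ChIn a → Bool) → ChOut a → Bool
  | 0, y, .inl _ => y (.inl ())
  | 0, _, .inr p => p.1.elim0
  | a + 1, y, .inl u => chainFn a (chainRest y) (.inl u)
  | a + 1, y, .inr (j, cpt) =>
    Fin.cases (mdIn y (some cpt)) (fun j' => chainFn a (chainRest y) (.inr (j', cpt))) j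

/-- **Conservation law of the chain**: `r + Σ pairs = s + 2 · Σ carry pairs`. [cite: KulikovPechenevSlezkin2022, §3.1.1] -/
theorem chainFn_spec : ∀ (a : ℕ) (y : ChIn a → Bool),
    (y (.inl ())).toNat + ppVal (fun p => y (.inr p)) =
      (chainFn a y (.inl ())).toNat + 2 * upPairsVal fun u => chainFn a y (.inr u)
  | 0, y => by simp [chainFn]
  | a + 1, y => by
    have ih := chainFn_spec a (chainRest y)
    have hmd := mdfa_spec (y (.inl ())) (y (.inr (0, false, false))) (y (.inr (0, false, true)))
      (y (.inr (0, true, false))) (y (.inr (0, true, true)))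
    rw [ppVal_succ, upPairsVal_succ]
    simp only [chainFn, Fin.cases_zero, Fin.cases_succ]
    simp only [chainRest, Sum.elim_inl, Sum.elim_inr, mdIn, mdOut, Prod.mk.eta] at ih ⊢
    omega

/-- **The chain of `a` MDFAs costs `8a` gates.** [cite: KulikovPechenevSlezkin2022, §3.1.1] -/
theorem cktSize_chain : ∀ a : ℕ, CktSize B2 (chainFn a) (8 * a)
  | 0 => (CktSize.proj B2 fun o : ChOut 0 => match o with
      | .inl _ => (Sum.inl () : ChIn 0)
      | .inr p => p.1.elim0).congr fun y o => by
        rcases o with _ | ⟨j, _⟩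
        · rfl
        · exact j.elim0
  | a + 1 => by
    -- stage 1: the first MDFA, keeping all inputs
    have h1 : CktSize B2 (fun (y : ChIn (a + 1) → Bool) => Sum.elim y (mdIn y)) 8 :=
      (cktSize_mdfa (ι := ChIn (a + 1)) (.inl ()) (.inr (0, false, false)) (.inr (0, false, true))
        (.inr (0, true, false)) (.inr (0, true, true))).keep
    -- stage 2: the remaining chain on (sum bit, other pairs), passing the carry pair through
    let e : ChIn a → ChIn (a + 1) ⊕ Option Bool :=
      Sum.elim (fun _ => .inr none) fun p => .inl (.inr (p.1.succ, p.2))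
    have h2 : CktSize B2 (fun (z : ChIn (a + 1) ⊕ Option Bool → Bool) =>
        Sum.elim (chainFn a fun i => z (e i)) fun cpt : Bool => z (.inr (some cpt))) (8 * a + 0) :=
      ((cktSize_chain a).rewire e).pair (CktSize.proj B2 fun cpt : Bool => Sum.inr (some cpt))
    have h3 := h1.comp h2
    refine ((h3.outMap fun o : ChOut (a + 1) => match o with
      | .inl u => Sum.inl (Sum.inl u)
      | .inr (j, cpt) => Fin.cases (Sum.inr cpt) (fun j' => Sum.inl (Sum.inr (j', cpt))) j).of_le
      (by omega)).congr fun y o => ?_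
    have hr : (fun i => Sum.elim y (mdIn y) (e i)) = chainRest y := by
      funext i
      rcases i with _ | ⟨j, w, cpt⟩ <;> rfl
    rcases o with u | ⟨j, cpt⟩
    · simp only [Sum.elim_inl, chainFn, hr]
    · refine Fin.cases ?_ (fun j' => ?_) j
      · simp only [Fin.cases_zero, Sum.elim_inr, chainFn]
      · simp only [Fin.cases_succ, Sum.elim_inl, chainFn, hr]

end Literature.Computability.Complexity

namespace Literature.Computability.Complexity

open Finset GateList

/-! ### One level, shape (1,0): a lone running bit and `2a` pairs -/

/-- Chain input of shape (1,0): the lone bit is the running bit. [folklore] -/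
def cin₁₀ {a : ℕ} (y : LIn 1 0 a → Bool) : ChIn a → Bool :=
  Sum.elim (fun _ => y (.inl 0)) fun p => y (.inr (.inr p))

/-- Level of shape (1,0): just the MDFA chain. [folklore] -/
def levelFn₁₀ (a : ℕ) (y : LIn 1 0 a → Bool) : Unit ⊕ LUp 0 a → Bool
  | .inl u => chainFn a (cin₁₀ y) (.inl u)
  | .inr (.inl i) => i.elim0
  | .inr (.inr u) => chainFn a (cin₁₀ y) (.inr u)

/-- Conservation law, shape (1,0). [folklore] -/
theorem levelFn₁₀_spec (a : ℕ) (y : LIn 1 0 a → Bool) :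
    lval y = (levelFn₁₀ a y (.inl ())).toNat + 2 * upVal fun u => levelFn₁₀ a y (.inr u) := by
  have h := chainFn_spec a (cin₁₀ y)
  simp only [cin₁₀, Sum.elim_inl, Sum.elim_inr] at h
  simp only [lval, upVal, levelFn₁₀, Fin.sum_univ_one, Finset.univ_eq_empty, Finset.sum_empty,
    add_zero, zero_add, Fin.isValue]
  exact h

/-- Gate count, shape (1,0): `8a`. [folklore] -/
theorem cktSize_level₁₀ (a : ℕ) : CktSize B2 (levelFn₁₀ a) (8 * a) := by
  let e : ChIn a → LIn 1 0 a := Sum.elim (fun _ => .inl 0) fun p => .inr (.inr p)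
  refine (((cktSize_chain a).rewire e).outMap fun o : Unit ⊕ LUp 0 a => match o with
    | .inl u => Sum.inl u
    | .inr (.inl i) => i.elim0
    | .inr (.inr u) => Sum.inr u).congr fun y o => ?_
  have hr : (fun i => y (e i)) = cin₁₀ y := funext fun i => by rcases i with _ | _ <;> rfl
  rcases o with u | i | u
  · simp only [hr]; rfl
  · exact i.elim0
  · simp only [hr]; rfl

/-! ### One level, shape (1,1): a lone bit, an odd pair and `2a` pairs -/

/-- Sum bit of the full adder absorbing the odd pair into the lone bit. [folklore] -/
def fa₁₁S {a : ℕ} (y : LIn 1 1 a → Bool) : Bool := faS (y (.inl 0)) (y (.inr (.inl (0, false))))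

/-- Carry of that full adder. [folklore] -/
def fa₁₁C {a : ℕ} (y : LIn 1 1 a → Bool) : Bool :=
  faC (y (.inl 0)) (y (.inr (.inl (0, false)))) (y (.inr (.inl (0, true))))

/-- Chain input of shape (1,1): the full adder's sum bit is the running bit. [folklore] -/
def cin₁₁ {a : ℕ} (y : LIn 1 1 a → Bool) : ChIn a → Bool :=
  Sum.elim (fun _ => fa₁₁S y) fun p => y (.inr (.inr p))

/-- Level of shape (1,1): full adder, then the MDFA chain; the adder's carry is the lone carry. [folklore] -/
def levelFn₁₁ (a : ℕ) (y : LIn 1 1 a → Bool) : Unit ⊕ LUp 1 a → Bool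
  | .inl u => chainFn a (cin₁₁ y) (.inl u)
  | .inr (.inl _) => fa₁₁C y
  | .inr (.inr u) => chainFn a (cin₁₁ y) (.inr u)

/-- Conservation law, shape (1,1). [folklore] -/
theorem levelFn₁₁_spec (a : ℕ) (y : LIn 1 1 a → Bool) :
    lval y = (levelFn₁₁ a y (.inl ())).toNat + 2 * upVal fun u => levelFn₁₁ a y (.inr u) := by
  have h := chainFn_spec a (cin₁₁ y)
  have hfa := fa_spec (y (.inl 0)) (y (.inr (.inl (0, false)))) (y (.inr (.inl (0, true))))
  have e1 : cin₁₁ y (.inl ()) = fa₁₁S y := rfl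
  have e2 : (fun p => cin₁₁ y (.inr p)) = fun p => y (.inr (.inr p)) := rfl
  rw [e1, e2] at h
  simp only [lval, upVal, levelFn₁₁, fa₁₁C, fa₁₁S, Fin.sum_univ_one, Fin.isValue] at h ⊢
  omega

/-- Gate count, shape (1,1): `8a + 4`. [folklore] -/
theorem cktSize_level₁₁ (a : ℕ) : CktSize B2 (levelFn₁₁ a) (8 * a + 4) := by
  have h1 : CktSize B2 (fun (y : LIn 1 1 a → Bool) => Sum.elim y fun o : Bool =>
      cond o (fa₁₁C y) (fa₁₁S y)) 4 :=
    (cktSize_fa (ι := LIn 1 1 a) (.inl 0) (.inr (.inl (0, false))) (.inr (.inl (0, true)))).keep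
  let e : ChIn a → LIn 1 1 a ⊕ Bool := Sum.elim (fun _ => .inr false) fun p => .inl (.inr (.inr p))
  have h2 : CktSize B2 (fun (z : LIn 1 1 a ⊕ Bool → Bool) =>
      Sum.elim (chainFn a fun i => z (e i)) fun _ : Unit => z (.inr true)) (8 * a + 0) :=
    ((cktSize_chain a).rewire e).pair (CktSize.proj B2 fun _ : Unit => Sum.inr true)
  refine (((h1.comp h2).outMap fun o : Unit ⊕ LUp 1 a => match o with
    | .inl u => Sum.inl (Sum.inl u)
    | .inr (.inl _) => Sum.inr ()
    | .inr (.inr u) => Sum.inl (Sum.inr u)).of_le (by omega)).congr fun y o => ?_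
  have hr : (fun i => Sum.elim y (fun o : Bool => cond o (fa₁₁C y) (fa₁₁S y)) (e i)) = cin₁₁ y :=
    funext fun i => by rcases i with _ | _ <;> rfl
  rcases o with u | i | u
  · simp only [Sum.elim_inl, hr]; rfl
  · rfl
  · simp only [Sum.elim_inl, hr]; rfl

/-! ### One level, shape (0,1): no lone bit, an odd pair and `2a` pairs -/

/-- Chain input of shape (0,1): the odd pair is split, its `P` bit is the running bit. [folklore] -/
def cin₀₁ {a : ℕ} (y : LIn 0 1 a → Bool) : ChIn a → Bool :=
  Sum.elim (fun _ => y (.inr (.inl (0, false)))) fun p => y (.inr (.inr p))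

/-- Level of shape (0,1): split, then the MDFA chain; the split carry is the lone carry. [folklore] -/
def levelFn₀₁ (a : ℕ) (y : LIn 0 1 a → Bool) : Unit ⊕ LUp 1 a → Bool
  | .inl u => chainFn a (cin₀₁ y) (.inl u)
  | .inr (.inl _) => spC (y (.inr (.inl (0, false)))) (y (.inr (.inl (0, true))))
  | .inr (.inr u) => chainFn a (cin₀₁ y) (.inr u)

/-- Conservation law, shape (0,1). [folklore] -/
theorem levelFn₀₁_spec (a : ℕ) (y : LIn 0 1 a → Bool) :
    lval y = (levelFn₀₁ a y (.inl ())).toNat + 2 * upVal fun u => levelFn₀₁ a y (.inr u) := by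
  have h := chainFn_spec a (cin₀₁ y)
  have hsp := spC_spec (y (.inr (.inl (0, false)))) (y (.inr (.inl (0, true))))
  have e1 : cin₀₁ y (.inl ()) = y (.inr (.inl (0, false))) := rfl
  have e2 : (fun p => cin₀₁ y (.inr p)) = fun p => y (.inr (.inr p)) := rfl
  rw [e1, e2] at h
  simp only [lval, upVal, levelFn₀₁, Fin.sum_univ_one, Finset.univ_eq_empty, Finset.sum_empty,
    zero_add, Fin.isValue] at h ⊢
  omega

/-- Gate count, shape (0,1): `8a + 1`. [folklore] -/
theorem cktSize_level₀₁ (a : ℕ) : CktSize B2 (levelFn₀₁ a) (8 * a + 1) := by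
  have h1 : CktSize B2 (fun (y : LIn 0 1 a → Bool) => Sum.elim y fun _ : Unit =>
      spC (y (.inr (.inl (0, false)))) (y (.inr (.inl (0, true))))) 1 :=
    (cktSize_bin (fun v P => v && !P) (Sum.inr (Sum.inl (0, true))) (Sum.inr (Sum.inl (0, false)))).keep
  let e : ChIn a → LIn 0 1 a ⊕ Unit :=
    Sum.elim (fun _ => .inl (.inr (.inl (0, false)))) fun p => .inl (.inr (.inr p))
  have h2 : CktSize B2 (fun (z : LIn 0 1 a ⊕ Unit → Bool) =>
      Sum.elim (chainFn a fun i => z (e i)) fun _ : Unit => z (.inr ())) (8 * a + 0) :=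
    ((cktSize_chain a).rewire e).pair (CktSize.proj B2 fun _ : Unit => Sum.inr ())
  refine (((h1.comp h2).outMap fun o : Unit ⊕ LUp 1 a => match o with
    | .inl u => Sum.inl (Sum.inl u)
    | .inr (.inl _) => Sum.inr ()
    | .inr (.inr u) => Sum.inl (Sum.inr u)).of_le (by omega)).congr fun y o => ?_
  have hr : (fun i => Sum.elim y (fun _ : Unit =>
      spC (y (.inr (.inl (0, false)))) (y (.inr (.inl (0, true))))) (e i)) = cin₀₁ y :=
    funext fun i => by rcases i with _ | _ <;> rfl
  rcases o with u | i | u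
  · simp only [Sum.elim_inl, hr]; rfl
  · rfl
  · simp only [Sum.elim_inl, hr]; rfl

/-! ### One level, shape (0,0): no lone bit, no odd pair, `2(a+1)` pairs -/

/-- Shape (0,0): the split carry of pair `(0,0)`. [folklore] -/
def sp₀₀C {a : ℕ} (y : LIn 0 0 (a + 1) → Bool) : Bool :=
  spC (y (.inr (.inr (0, false, false)))) (y (.inr (.inr (0, false, true))))

/-- Shape (0,0): sum bit of the full adder of the split bit `P₀₀` and pair `(0,1)`. [folklore] -/
def fa₀₀S {a : ℕ} (y : LIn 0 0 (a + 1) → Bool) : Bool :=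
  faS (y (.inr (.inr (0, false, false)))) (y (.inr (.inr (0, true, false))))

/-- Shape (0,0): carry of that full adder. [folklore] -/
def fa₀₀C {a : ℕ} (y : LIn 0 0 (a + 1) → Bool) : Bool :=
  faC (y (.inr (.inr (0, false, false)))) (y (.inr (.inr (0, true, false))))
    (y (.inr (.inr (0, true, true))))

/-- Chain input of shape (0,0): running bit = the full adder's sum bit, pairs `1 … a`. [folklore] -/
def cin₀₀ {a : ℕ} (y : LIn 0 0 (a + 1) → Bool) : ChIn a → Bool :=
  Sum.elim (fun _ => fa₀₀S y) fun p => y (.inr (.inr (p.1.succ, p.2)))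

/-- Level of shape (0,0): split pair `(0,0)`, full-add pair `(0,1)`, re-encode the two carries
`{c₁, c₂}` as the carry pair `(c₁ ⊕ c₂, c₂)`, then the MDFA chain on the other pairs. [folklore] -/
def levelFn₀₀ (a : ℕ) (y : LIn 0 0 (a + 1) → Bool) : Unit ⊕ LUp 0 (a + 1) → Bool
  | .inl u => chainFn a (cin₀₀ y) (.inl u)
  | .inr (.inl i) => i.elim0
  | .inr (.inr (j, cpt)) => Fin.cases (cond cpt (fa₀₀C y) (xor (sp₀₀C y) (fa₀₀C y)))
      (fun j' => chainFn a (cin₀₀ y) (.inr (j', cpt))) j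

/-- Conservation law, shape (0,0). [folklore] -/
theorem levelFn₀₀_spec (a : ℕ) (y : LIn 0 0 (a + 1) → Bool) :
    lval y = (levelFn₀₀ a y (.inl ())).toNat + 2 * upVal fun u => levelFn₀₀ a y (.inr u) := by
  have h := chainFn_spec a (cin₀₀ y)
  have hsp := spC_spec (y (.inr (.inr (0, false, false)))) (y (.inr (.inr (0, false, true))))
  have hfa := fa_spec (y (.inr (.inr (0, false, false)))) (y (.inr (.inr (0, true, false))))
    (y (.inr (.inr (0, true, true))))
  have hx := pairVal_xor (sp₀₀C y) (fa₀₀C y)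
  have e1 : cin₀₀ y (.inl ()) = fa₀₀S y := rfl
  have e2 : (fun p => cin₀₀ y (.inr p)) = fun p : PPIdx a => y (.inr (.inr (p.1.succ, p.2))) := rfl
  rw [e1, e2] at h
  simp only [lval, upVal, levelFn₀₀, Finset.univ_eq_empty, Finset.sum_empty, zero_add,
    upPairsVal_succ, Fin.cases_zero, Fin.cases_succ, ppVal_succ, cond_true, cond_false,
    sp₀₀C, fa₀₀C, fa₀₀S, Prod.mk.eta] at hx h ⊢
  omega

/-- Gate count, shape (0,0): `8a + 6`. [folklore] -/
theorem cktSize_level₀₀ (a : ℕ) : CktSize B2 (levelFn₀₀ a) (8 * a + 6) := by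
  -- the split carry c₁ (1 gate) and the full adder (4 gates), keeping the inputs
  have h1 : CktSize B2 (fun (y : LIn 0 0 (a + 1) → Bool) => Sum.elim y (Sum.elim
      (fun _ : Unit => sp₀₀C y) (fun o : Bool => cond o (fa₀₀C y) (fa₀₀S y)))) (0 + (1 + 4)) :=
    (CktSize.id B2).pair ((cktSize_bin (fun v P => v && !P) (Sum.inr (Sum.inr (0, false, true)))
      (Sum.inr (Sum.inr (0, false, false)))).pair (cktSize_fa (ι := LIn 0 0 (a + 1))
      (.inr (.inr (0, false, false))) (.inr (.inr (0, true, false))) (.inr (.inr (0, true, true)))))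
  -- the re-encoding XOR c₁ ⊕ c₂
  have h2 := h1.andThen xor (.inr (.inl ())) (.inr (.inr true))
  -- the chain on (sum bit, pairs 1..a), passing c₂ and c₁ ⊕ c₂ through
  let e : ChIn a → (LIn 0 0 (a + 1) ⊕ (Unit ⊕ Bool)) ⊕ Unit :=
    Sum.elim (fun _ => .inl (.inr (.inr false))) fun p => .inl (.inl (.inr (.inr (p.1.succ, p.2))))
  have h3 : CktSize B2 (fun (z : (LIn 0 0 (a + 1) ⊕ (Unit ⊕ Bool)) ⊕ Unit → Bool) =>
      Sum.elim (chainFn a fun i => z (e i)) fun cpt : Bool =>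
        z (cond cpt (Sum.inl (Sum.inr (Sum.inr true))) (Sum.inr ()))) (8 * a + 0) :=
    ((cktSize_chain a).rewire e).pair (CktSize.proj B2 fun cpt : Bool =>
      cond cpt (Sum.inl (Sum.inr (Sum.inr true))) (Sum.inr ()))
  refine (((h2.comp h3).outMap fun o : Unit ⊕ LUp 0 (a + 1) => match o with
    | .inl u => Sum.inl (Sum.inl u)
    | .inr (.inl i) => i.elim0
    | .inr (.inr (j, cpt)) => Fin.cases (Sum.inr cpt) (fun j' => Sum.inl (Sum.inr (j', cpt))) j).of_le
    (by omega)).congr fun y o => ?_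
  have hr : (fun i => Sum.elim (Sum.elim y (Sum.elim (fun _ : Unit => sp₀₀C y)
      (fun o : Bool => cond o (fa₀₀C y) (fa₀₀S y))))
      (fun _ : Unit => xor (sp₀₀C y) (fa₀₀C y)) (e i)) = cin₀₀ y :=
    funext fun i => by rcases i with _ | _ <;> rfl
  rcases o with u | i | ⟨j, cpt⟩
  · exact congrFun (congrArg (chainFn a) hr) (Sum.inl u)
  · exact i.elim0
  · refine Fin.cases ?_ (fun j' => ?_) j
    · cases cpt <;> rfl
    · simp only [Fin.cases_succ, Sum.elim_inl]
      exact congrFun (congrArg (chainFn a) hr) (Sum.inr (j', cpt))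

end Literature.Computability.Complexity
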